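import Summits.QuantumAdvantage.QuantumAdvantage.Theses.CommutingDeciders
import Literature.Computability.Complexity.PromiseZPPProofs

/-!
# Line `promise-sign` — skeleton for the piece `CommutingDeciders.CommutingPromiseWitness` (X₁)
of the split `CommutingWitness ⟸ CommutingPromiseWitness ∧ CommutingPromiseLift`
(crux item stmt-QuantumAdvantage-2639 `CommutingWitness`, route `route-QuantumAdvantage-CommutingDeciders`;
crux-strategist decomposition, 2026-08-17).

PIECE (X₁, by name after the split; defined locally below with the IDENTICAL text until the gate writes it):
some PROMISE problem `Q ∉ PromiseBPP'` has a one-shot commuting decider over `iqpDiag = {Z, CZ, T}` whose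
2/3-vs-1/3 gap is required on `Q.yes` / `Q.no` only.

THE LINE (2 content stubs + 1 sibling-piece stub, composed WITHOUT hypotheses by `CommutingPromiseWitness_of` /
`CommutingWitness_of`, kernel-checked):
* `stub_signDecider` (PROVABLE NOW on tree rails; M–L formalisation): for EVERY sigma-uniform family
  `x ↦ D_x` of `{Z,CZ,T}` circuits, the Z4-WEIGHT-SIGN promise problem
  `signProblem W D = ({x : 1/3 ≤ s x}, {x : s x ≤ -1/3})`, `s x = Re Σ_w |⟨w|H D_x H|0⟩|² · i^{|w|}`,
  has a one-shot commuting promise-decider: ONE IQP circuit made of `k = 40` block-disjoint copies of `D_x`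
  (`H^{⊗kW}(D_x ⊗ … ⊗ D_x)H^{⊗kW}`; output law = product law — rails `CircuitEmbedding.mapWires`,
  `toMatrix_flatMap_mapWires_mulVec_prodState`, `JuxtaposedDeciders`, `PolyCopies*`, `IndepProductLaw`),
  verdict `[(1/k) Σ_t cos(π|w_t|/2) > 0] ∈ P`, Hoeffding (`|cos| ≤ 1`, mean `s x`, gap `1/3`:
  error `≤ exp(-k/18) < 1/3`), sigma-uniformity of `x ↦ ⟨kW_x, 0, D_x^{⊔k}⟩` from that of `D_x`.
  This is the route's support `WeightCharacterGivesWitness` (stmt-2643) MINUS TOTALITY: no promise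
  `|s x| ≥ 1/3 ∀ x` is needed, because only `Q.yes`/`Q.no` carry a gap requirement.
* `stub_signHardPromise` (OPEN, hypothesis-grade, the load-bearing stub; STRICTLY WEAKER than the route's
  crux C = `WeightCharacterSignHard` (stmt-2642): C asks in addition for the TOTAL promise `|s x| ≥ 1/3 ∀ x`
  and then `signProblem = ofLanguage {s > 0}`): SOME sigma-uniform `{Z,CZ,T}` family has its Z4-weight-sign
  promise problem outside `PromiseBPP'`.  White-box residue of Buzet–Chailloux 2026 (arXiv:2604.15248,
  Thms 1–3: relative to an oracle, single-query IQP circuits decide signed 2-Forrelation, outside PH):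
  F2-linear statistics of `{Z,CZ,T}` laws are classical (tree
  `Literature.Barriers.QuantumAdvantage.UncorrectedNoiseIQP.cubeFourierCoeff_iqpProb_eq_prod`), the
  Z4 weight character `i^{|w|}` is the first non-classical one; `E[i^{|w|}] = ⟨G_T| ⊗_j R_j |G_T⟩` is the
  overlap of a T-decorated graph state with its image under single-qubit π/2 rotations about XY-axes at
  angle `πc_j/4` = a signed, `2^{-|A|/2}`-weighted count of the "even-outside" vertex sets `A` of the CZ-graph
  (stabilizer expansion), a T-depth-2 Clifford+T amplitude computable in `2^{O(t)}·poly` for T-count `t`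
  (Bravyi–Gosset 2016) — so witnesses need `t = ω(log n)`; classical status of the ±1/6 estimate OPEN.
  Why it might fail: stabilizer-rank / peakedness arguments (Bravyi et al. 2019; Bravyi–Gosset–Liu 2023)
  may estimate `s` to ±1/6 whenever `|s| ≥ 1/3` forces structure — that refutes THIS LINE (route kill
  criterion (ii)), not the piece X₁ (other P-verdicts of exponential Fourier l1-mass remain).

Costume / shred self-check: neither stub restates X₁, X, the summit or a refuted statement
(`ledger negatives`: to re-run when the gate is back); `stub_signDecider` has no hardness content,
`stub_signHardPromise` has no decider content; BC3 probes (stub → X₁, stub → S) in `bc/stub_probes_X1.lean`.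
Disproof used: none exists yet for this crux (`Cruxes/CommutingWitness/` is created by this line).
-/

noncomputable section

namespace Summit.QuantumAdvantage.QuantumAdvantage.Theses.CommutingDeciders

open scoped BigOperators Classical Matrix
open Literature.Computability.Cryptography Literature.Computability.Complexity

-- ⟨PIECE-DEF: identical text to Sketch.lean / children.json (gen.py); REMOVED after the split, when the
--  gate writes `CommutingPromiseWitness` into Theses/CommutingDeciders.lean⟩
/-- X₁ — COMMUTING PROMISE WITNESS (piece of the split of `CommutingWitness`). -/
def CommutingPromiseWitness : Prop :=
  ∃ Q : PromiseProblem, Q ∉ PromiseBPP' ∧ ∃ (W : List Bool → ℕ) (D : (x : List Bool) → QCircuit iqpDiag (W x)) (A : Language Bool), A ∈ Classes.P ∧ PolyTimeComputable (id : List Bool → List Bool) (QCircuit.sigmaEncode (G := iqpDiag)) (fun x => (⟨W x, 0, D x⟩ : Σ n m : ℕ, QCircuit iqpDiag (n + m))) ∧ (∀ x ∈ Q.yes, (2 / 3 : ℝ) ≤ ∑ w : QReg (W x), (if boolPair x (List.ofFn w) ∈ A then ‖(iqpUnitary (D x) *ᵥ basisState (fun _ => false)) w‖ ^ 2 else 0))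 ∧ (∀ x ∈ Q.no, ∑ w : QReg (W x), (if boolPair x (List.ofFn w) ∈ A then ‖(iqpUnitary (D x) *ᵥ basisState (fun _ => false)) w‖ ^ 2 else 0) ≤ (1 / 3 : ℝ))

/-- X₂ — COMMUTING PROMISE→LANGUAGE LIFT (the sibling piece; used only in `CommutingWitness_of` below). -/
def CommutingPromiseLift : Prop :=
  (∀ L : Language Bool, (∃ (W : List Bool → ℕ) (D : (x : List Bool) → QCircuit iqpDiag (W x)) (A : Language Bool), A ∈ Classes.P ∧ PolyTimeComputable (id : List Bool → List Bool) (QCircuit.sigmaEncode (G := iqpDiag)) (fun x => (⟨W x, 0, D x⟩ : Σ n m : ℕ, QCircuit iqpDiag (n + m))) ∧ ∀ x : List Bool, (x ∈ L → (2 / 3 : ℝ) ≤ ∑ w : QReg (W x), (if boolPair x (List.ofFn w) ∈ A then ‖(iqpUnitary (D x) *ᵥ basisState (fun _ => false)) w‖ ^ 2 else 0)) ∧ (x ∉ L → ∑ w : QReg (W x), (if boolPair x (List.ofFn w) ∈ A then ‖(iqpUnitary (D x) *ᵥ basisState (fun _ => false)) w‖ ^ 2 else 0) ≤ (1 / 3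 : ℝ))) → L ∈ BPP) → ∀ Q : PromiseProblem, (∃ (W : List Bool → ℕ) (D : (x : List Bool) → QCircuit iqpDiag (W x)) (A : Language Bool), A ∈ Classes.P ∧ PolyTimeComputable (id : List Bool → List Bool) (QCircuit.sigmaEncode (G := iqpDiag)) (fun x => (⟨W x, 0, D x⟩ : Σ n m : ℕ, QCircuit iqpDiag (n + m))) ∧ (∀ x ∈ Q.yes, (2 / 3 : ℝ) ≤ ∑ w : QReg (W x), (if boolPair x (List.ofFn w) ∈ A then ‖(iqpUnitary (D x) *ᵥ basisState (fun _ => false)) w‖ ^ 2 else 0)) ∧ (∀ x ∈ Q.no, ∑ w : QReg (W x), (if boolPair x (List.ofFn w) ∈ A then ‖(iqpUnitary (D x) *ᵥ basisState (fun _ => false)) w‖ ^ 2 else 0) ≤ (1 / 3 : ℝ))) → Q ∈ PromiseBPP'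
-- ⟨/PIECE-DEF⟩

end Summit.QuantumAdvantage.QuantumAdvantage.Theses.CommutingDeciders

namespace Summit.QuantumAdvantage.QuantumAdvantage.Cruxes.CommutingWitness.PromiseSign

open scoped BigOperators Classical Matrix
open Literature.Computability.Cryptography Literature.Computability.Complexity
open Summit.QuantumAdvantage.QuantumAdvantage.Theses.CommutingDeciders

/-- The Z4-weight statistic of the route's crux C: `s x = Re Σ_w |⟨w| H^{⊗W} D_x H^{⊗W} |0^W⟩|² · i^{|w|}`
(`|w|` = Hamming weight), i.e. `Re E_{w ∼ IQP law of D_x}[i^{|w|}] = E[cos(π|w|/2)]`. -/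
def zFourWeight (W : List Bool → ℕ) (D : (x : List Bool) → QCircuit iqpDiag (W x)) (x : List Bool) : ℝ :=
  (∑ w : QReg (W x), ((‖(iqpUnitary (D x) *ᵥ basisState (fun _ => false)) w‖ ^ 2 : ℝ) : ℂ) *
    Complex.I ^ (Finset.univ.filter (fun i : Fin (W x) => w i = true)).card).re

/-- The Z4-WEIGHT-SIGN promise problem of a family: yes = `{x : 1/3 ≤ s x}`, no = `{x : s x ≤ -1/3}`. -/
def signProblem (W : List Bool → ℕ) (D : (x : List Bool) → QCircuit iqpDiag (W x)) : PromiseProblem :=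
  ⟨{x | (1 / 3 : ℝ) ≤ zFourWeight W D x}, {x | zFourWeight W D x ≤ -(1 / 3 : ℝ)}⟩

/-- **stub_signDecider** (provable now; M–L). Every sigma-uniform `{Z,CZ,T}` family's Z4-weight-sign
promise problem has a one-shot commuting PROMISE-decider (40 block-disjoint copies, verdict = majority
sign of `cos(π|w_t|/2)`, Hoeffding; product law of juxtaposed IQP circuits). -/
theorem stub_signDecider :
    ∀ (W : List Bool → ℕ) (D : (x : List Bool) → QCircuit iqpDiag (W x)),
      PolyTimeComputable (id : List Bool → List Bool) (QCircuit.sigmaEncode (G := iqpDiag))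
        (fun x => (⟨W x, 0, D x⟩ : Σ n m : ℕ, QCircuit iqpDiag (n + m))) →
      ∃ (W' : List Bool → ℕ) (D' : (x : List Bool) → QCircuit iqpDiag (W' x)) (A' : Language Bool), A' ∈ Classes.P ∧ PolyTimeComputable (id : List Bool → List Bool) (QCircuit.sigmaEncode (G := iqpDiag)) (fun x => (⟨W' x, 0, D' x⟩ : Σ n m : ℕ, QCircuit iqpDiag (n + m))) ∧ (∀ x ∈ (signProblem W D).yes, (2 / 3 : ℝ) ≤ ∑ w : QReg (W' x), (if boolPair x (List.ofFn w) ∈ A' then ‖(iqpUnitary (D' x) *ᵥ basisState (fun _ => false)) w‖ ^ 2 else 0)) ∧ (∀ x ∈ (signProblem W D).no, ∑ w : QReg (W' x), (if boolPair x (List.ofFn w) ∈ A' then ‖(iqpUnitary (D' x) *ᵥ basisState (fun _ => false)) w‖ ^ 2 else 0) ≤ (1 / 3 : ℝ)) := by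
  sorry

/-- **stub_signHardPromise** (OPEN; the load-bearing stub; = crux C minus totality). Some sigma-uniform
`{Z,CZ,T}` family has its Z4-weight-sign promise problem outside textbook promise-BPP. -/
theorem stub_signHardPromise :
    ∃ (W : List Bool → ℕ) (D : (x : List Bool) → QCircuit iqpDiag (W x)),
      PolyTimeComputable (id : List Bool → List Bool) (QCircuit.sigmaEncode (G := iqpDiag))
        (fun x => (⟨W x, 0, D x⟩ : Σ n m : ℕ, QCircuit iqpDiag (n + m))) ∧
      signProblem W D ∉ PromiseBPP' := by
  sorry

/-- **stub_promiseLift** — the SIBLING PIECE X₂ (`CommutingPromiseLift`), an item of the route after the split, with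
its own registered line `Lines/totalize.lean`; declared here as a stub ONLY so that this line concludes the registered
crux `CommutingWitness` by name before the split is applied (afterwards this stub is deleted and X₂ enters
`CommutingWitness_of` as the route item, by name). Not part of this line's content. -/
theorem stub_promiseLift : CommutingPromiseLift := by
  sorry

/-- COMPOSITION, piece level (kernel-checked, no sorry of its own, no hypotheses): the two content stubs give the
piece X₁ BY NAME. -/
theorem CommutingPromiseWitness_of : CommutingPromiseWitness := by
  obtain ⟨W, D, hU, hQ⟩ := stub_signHardPromise
  exact ⟨signProblem W D, hQ, stub_signDecider W D hU⟩

/-- COMPOSITION, crux level (kernel-checked, no sorry of its own, no hypotheses): with the sibling piece, the line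
reaches the REGISTERED crux `CommutingDeciders.CommutingWitness` BY NAME (the split glue `X₁ → X₂ → X`, inlined). -/
theorem CommutingWitness_of :
    Summit.QuantumAdvantage.QuantumAdvantage.Theses.CommutingDeciders.CommutingWitness := by
  have h₁ : CommutingPromiseWitness := CommutingPromiseWitness_of
  have h₂ : CommutingPromiseLift := stub_promiseLift
  by_contra hX
  obtain ⟨Q, hQ, hdecQ⟩ := h₁
  refine hQ (h₂ ?_ Q hdecQ)
  intro L hL
  by_contra hBPP
  exact hX ⟨L, hBPP, hL⟩

end Summit.QuantumAdvantage.QuantumAdvantage.Cruxes.CommutingWitness.PromiseSign
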